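import Mathlib.Analysis.SpecialFunctions.Log.NegMulLog
import Mathlib.MeasureTheory.Function.ConditionalExpectation.Basic
import Mathlib.Dynamics.Ergodic.MeasurePreserving
import Mathlib.MeasureTheory.Measure.Typeclasses.Probability
import HarnessLib

/-!
# Kolmogorov–Sinai (measure-theoretic) entropy

Topic `Literature/Dynamics/Ergodic` (Mathlib precedent `Mathlib/Dynamics/…`; Mathlib 2026-08 has
only *topological* entropy, `Mathlib/Dynamics/TopologicalEntropy/…`, and no Shannon entropy of a
random variable or partition: `lean search 'entropy' --decl` finds nothing measure-theoretic).
Definition request `defn-KolmogorovSinaiEntropy` (route `MacroErgodicRigidity`,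
AtomisticToContinuum/FouriersLaw).

We follow Walters, *An Introduction to Ergodic Theory*, Ch. 4, with one representation choice:
a **finite measurable partition** `ξ = {A₁, …, A_k}` of the probability space `(Ω, 𝓑, μ)` is a
map `ξ : Ω → α` into a finite type (atoms `ξ ⁻¹' {a}`; Walters' one-to-one correspondence between
finite partitions and finite sub-σ-algebras, §4.1). In this language the join `ξ ∨ η` (Def 4.3)
is the pair map `fun ω ↦ (ξ ω, η ω)`, `ξ ≤ η` ("`η` refines `ξ`", Def 4.2) is `ξ = f ∘ η`, `T⁻¹ξ`
(Def 4.4) is `ξ ∘ T`, and `⋁_{i<n} T^{-i} ξ` is the **itinerary** map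
`itinerary T ξ n : Ω → (Fin n → α)`, `ω ↦ (ξ (Tⁱ ω))_{i<n}`, whose atoms are the sets
`⋂_{i<n} T^{-i} A_{w i}` (§4.4).

## Content (this file: the definitions and their elementary API)

* `partitionEntropy μ ξ = H_μ(ξ) = ∑_a φ(μ(ξ = a))`, `φ = Real.negMulLog` (`φ(x) = -x log x`,
  natural log, `0 log 0 = 0`) — Walters Def 4.6;
* `condPartitionEntropy μ ξ m = H_μ(ξ | m) = ∫ ∑_a φ(E_μ[1_{ξ = a} | m]) dμ` for an ARBITRARY
  sub-σ-algebra `m` (Mathlib's conditional expectation `μ[f|m]`) — Walters Def 4.8 (= Def 4.7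
  when `m` is finite);
* `itinerary T ξ n` — the join `⋁_{i<n} T^{-i} ξ` (Walters Def 4.4, §4.4);
* `dynEntropy μ T ξ = h_μ(T, ξ) = inf_{n ≥ 1} (1/n) H_μ(⋁_{i<n} T^{-i} ξ)` — Walters Def 4.9
  defines `h(T, ξ)` as the LIMIT of this sequence; by Walters Thm 4.9 (Fekete) / Cor 4.9.1 /
  Thm 4.10 the limit exists and equals the infimum (the sequence `(1/n)Hₙ` even decreases), so
  we take the infimum as the definition (no limit/junk issue) and prove the limit statement
  separately (`tendsto_partitionEntropy_itinerary_div`, companion file);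
* `condDynEntropy μ T ξ m = h_μ(T, ξ | m) = inf_{n ≥ 1} (1/n) H_μ(⋁_{i<n} T^{-i} ξ | m)` for a
  (sub-invariant) sub-σ-algebra `m` — Downarowicz, *Entropy in Dynamical Systems*, Def 2.3.3
  (`lim ↓ (1/n) H(𝒫ⁿ | 𝔅)`, `𝔅` subinvariant; again lim = inf by subadditivity, Fact 2.3.1);
* `kolmogorovSinaiEntropy μ T = h_μ(T) = sup_ξ h_μ(T, ξ) ∈ [0, ∞]`, the supremum over all
  finite measurable partitions, rendered as `⨆ (k : ℕ) (ξ : Ω → Fin k) (_ : Measurable ξ)` in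
  `ℝ≥0∞` — Walters Def 4.10 (any finite measurable partition is a relabelling of a `Fin k`-valued
  one, `ofReal_dynEntropy_le_kolmogorovSinaiEntropy`);
* `condKolmogorovSinaiEntropy μ T m = sup_ξ h_μ(T, ξ | m)` likewise — Downarowicz Def 4.1.5
  (conditional entropy of the system given its factor `m`; he lets the supremum run over
  countable partitions of finite entropy, we take finite ones as Walters does).

Elementary API proved here: non-negativity, `H(ξ | ⊥) = H(ξ)` (Walters §4.3, `H(𝒜/𝒩) = H(𝒜)`),
invariance under injective relabelling of the atoms, measurability and
atoms of itineraries, `h(T, ξ) ≤ h(T)`. The inequalities of Walters Thm 4.3 / 4.12 / 4.13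
(monotonicity under refinement, `H(ξ | m) ≤ H(ξ)` by conditional Jensen, subadditivity,
invariance under measure-preserving maps, existence of the limit, `h(T, ξ) ≤ H(ξ)`,
`h(Tᵏ) = k h(T)`, conjugacy invariance) are proved in the companion files
`KolmogorovSinaiEntropy*.lean` of this directory.

## Design choices / junk values
* Values: `H`, `H(·|m)`, `h(T,ξ)`, `h(T,ξ|m)` are real numbers (finite: `H ≤ log |α|`); `h(T)` is
  `ℝ≥0∞`-valued since it "could be `+∞`" (Walters, Remark (1) after Def 4.10).
* No measurability/probability hypotheses in the definitions; theorems assume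
  `IsProbabilityMeasure μ`, `Measurable ξ` into a `MeasurableSingletonClass` finite type (e.g.
  `Fin k`, whose σ-algebra is `⊤`), and `MeasurePreserving T μ μ` where needed. For a
  non-probability measure `μ.real` of an atom may exceed `1` and the numbers are meaningless
  (documented junk); if `m` is not a sub-σ-algebra of the ambient one Mathlib's `μ[·|m]` is `0`
  and `H(ξ | m) = 0`.
* `Real.iInf` of the (non-negative) sequence `(1/n) Hₙ` is a genuine infimum; indexing by `n + 1`
  avoids the `n = 0` term.
* NOT here: Walters Thm 4.10 (monotone decrease of `(1/n)Hₙ`), Thm 4.14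
  (`h(T,ξ) = H(ξ | ⋁_{i≥1} T^{-i}ξ)`), the Kolmogorov–Sinai generator theorem (Thm 4.17),
  Shannon–McMillan–Breiman, countable partitions.

## References
* P. Walters, *An Introduction to Ergodic Theory*, GTM 79, Springer 1982, Ch. 4 (Defs 4.1–4.10,
  Thms 4.3, 4.9–4.13).  [Walters1982]
* T. Downarowicz, *Entropy in Dynamical Systems*, New Mathematical Monographs 18, CUP 2011,
  §2.3 (Def 2.3.3, Fact 2.3.1), §4.1 (Defs 4.1.1, 4.1.5).  [Downarowicz2011]
* W. Parry, *Topics in Ergodic Theory*, CUP 1981, Ch. 2 §2 (`H(ξ|𝒜)` via conditional expectation).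
-/

noncomputable section

open MeasureTheory Filter Topology Function Real
open scoped ENNReal

namespace Literature.Dynamics.Ergodic

variable {Ω α β : Type*}

/-! ### Relabelling sums over atoms -/

/-- Reindexing a sum over the atoms of `e ∘ ξ` (`e` injective) as a sum over the atoms of `ξ`:
the atoms `(e ∘ ξ)⁻¹{b}` are `ξ⁻¹{a}` for `b = e a` and `∅` otherwise. [folklore] -/
theorem sum_preimage_comp_singleton_of_injective [Fintype α] [Fintype β] {M : Type*}
    [AddCommMonoid M] {e : α → β} (he : Injective e) (ξ : Ω → α) (F : Set Ω → M)
    (hF : F ∅ = 0) : ∑ b, F ((e ∘ ξ) ⁻¹' {b}) = ∑ a, F (ξ ⁻¹' {a}) := by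
  classical
  have h1 : ∀ b ∈ (Finset.univ : Finset β), b ∉ Finset.univ.image e →
      F ((e ∘ ξ) ⁻¹' {b}) = 0 := by
    intro b _ hb
    have : (e ∘ ξ) ⁻¹' {b} = ∅ := by
      ext ω
      simp only [Set.mem_preimage, comp_apply, Set.mem_singleton_iff, Set.mem_empty_iff_false,
        iff_false]
      rintro rfl
      exact hb (Finset.mem_image_of_mem e (Finset.mem_univ _))
    rw [this, hF]
  rw [← Finset.sum_subset (Finset.subset_univ (Finset.univ.image e)) h1,
    Finset.sum_image fun a _ a' _ h => he h]
  refine Finset.sum_congr rfl fun a _ => ?_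
  congr 1
  ext ω
  simp [he.eq_iff]

/-! ### Entropy and conditional entropy of a finite partition -/

section Partition

variable [Fintype α] [Fintype β]

/-- The **entropy of a finite partition** `ξ = {A₁, …, A_k}` of a probability space `(Ω, μ)`,
the partition being given as a map `ξ : Ω → α` into a finite type with atoms `A_a = ξ⁻¹{a}`:
`H_μ(ξ) = -∑_a μ(A_a) log μ(A_a) = ∑_a φ(μ(A_a))`, `φ = Real.negMulLog`, natural logarithm,
`0 log 0 = 0`. [cite: Walters1982, Def 4.6] -/
def partitionEntropy {mΩ : MeasurableSpace Ω} (μ : Measure Ω) (ξ : Ω → α) : ℝ :=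
  ∑ a, negMulLog (μ.real (ξ ⁻¹' {a}))

/-- The **conditional entropy of a finite partition given a sub-σ-algebra** `m`:
`H_μ(ξ | m) = -∫ ∑_a E(χ_{A_a} | m) log E(χ_{A_a} | m) dμ = ∫ ∑_a φ(μ[1_{A_a} | m]) dμ`, with
Mathlib's conditional expectation `μ[· | m]` (for a finite `m` generated by a partition `{C_j}`
this is `-∑_{i,j} μ(A_i ∩ C_j) log (μ(A_i ∩ C_j)/μ(C_j))`, Walters Def 4.7). If `m` is not a
sub-σ-algebra of the ambient one, Mathlib's `μ[·|m]` is `0` and the value is `0` (junk).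
[cite: Walters1982, Def 4.8] -/
def condPartitionEntropy {mΩ : MeasurableSpace Ω} (μ : Measure Ω) (ξ : Ω → α)
    (m : MeasurableSpace Ω) : ℝ :=
  ∫ ω, ∑ a, negMulLog ((μ[(ξ ⁻¹' {a}).indicator (fun _ => (1 : ℝ)) | m]) ω) ∂μ

variable {mΩ : MeasurableSpace Ω} {μ : Measure Ω}

/-- Unfolding `partitionEntropy`. [cite: Walters1982, Def 4.6] -/
theorem partitionEntropy_def (μ : Measure Ω) (ξ : Ω → α) :
    partitionEntropy μ ξ = ∑ a, negMulLog (μ.real (ξ ⁻¹' {a})) := rfl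

/-- Unfolding `condPartitionEntropy`. [cite: Walters1982, Def 4.8] -/
theorem condPartitionEntropy_def (μ : Measure Ω) (ξ : Ω → α) (m : MeasurableSpace Ω) :
    condPartitionEntropy μ ξ m =
      ∫ ω, ∑ a, negMulLog ((μ[(ξ ⁻¹' {a}).indicator (fun _ => (1 : ℝ)) | m]) ω) ∂μ := rfl

/-- `H(ξ) ≥ 0` (Walters §4.2 Remark (3)). [cite: Walters1982, §4.2 Remark (3)] -/
theorem partitionEntropy_nonneg [IsZeroOrProbabilityMeasure μ] (ξ : Ω → α) :
    0 ≤ partitionEntropy μ ξ :=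
  Finset.sum_nonneg fun _ _ => negMulLog_nonneg measureReal_nonneg measureReal_le_one

/-- The conditional probability `μ[1_s | m]` of a set lies in `[0, 1]` almost everywhere (Walters,
Remark after Def 4.8: "`0 ≤ E(χ_A/ℱ) ≤ 1` a.e."). [cite: Walters1982, §4.3 Remark after Def 4.8] -/
theorem ae_condExp_indicator_mem_Icc [IsFiniteMeasure μ] (s : Set Ω) (m : MeasurableSpace Ω) :
    ∀ᵐ ω ∂μ, (μ[s.indicator (fun _ => (1 : ℝ)) | m]) ω ∈ Set.Icc (0 : ℝ) 1 := by
  have h0 : 0 ≤ᵐ[μ] μ[s.indicator (fun _ => (1 : ℝ)) | m] :=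
    condExp_nonneg (Eventually.of_forall fun ω => Set.indicator_nonneg (fun _ _ => zero_le_one) ω)
  have h1 : μ[s.indicator (fun _ => (1 : ℝ)) | m] ≤ᵐ[μ] fun _ => (1 : ℝ) := by
    by_cases hm : m ≤ mΩ
    swap
    · rw [condExp_of_not_le hm]
      exact Eventually.of_forall fun _ => zero_le_one
    by_cases hint : Integrable (s.indicator fun _ => (1 : ℝ)) μ
    · have h := condExp_mono (m := m) hint (integrable_const (1 : ℝ))
        (Eventually.of_forall fun ω => Set.indicator_le_self' (fun _ _ => zero_le_one) ω)
      rw [condExp_const hm] at h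
      exact h
    · rw [condExp_of_not_integrable hint]
      exact Eventually.of_forall fun _ => zero_le_one
  filter_upwards [h0, h1] with ω h0 h1 using ⟨h0, h1⟩

/-- `H(ξ | m) ≥ 0` (Walters §4.3 Remark (1)). [cite: Walters1982, §4.3 Remark (1)] -/
theorem condPartitionEntropy_nonneg [IsFiniteMeasure μ] (ξ : Ω → α) (m : MeasurableSpace Ω) :
    0 ≤ condPartitionEntropy μ ξ m := by
  apply integral_nonneg_of_ae
  filter_upwards [ae_all_iff.2 fun a => ae_condExp_indicator_mem_Icc (μ := μ) (ξ ⁻¹' {a}) m]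
    with ω hω
  exact Finset.sum_nonneg fun a _ => negMulLog_nonneg (hω a).1 (hω a).2

/-- Conditioning on the trivial σ-algebra `𝒩 = {∅, Ω}` gives back the entropy: `H(ξ | 𝒩) = H(ξ)`
(Walters §4.3, sentence after Def 4.7). [cite: Walters1982, §4.3 after Def 4.7] -/
theorem condPartitionEntropy_bot [MeasurableSpace α] [MeasurableSingletonClass α]
    [IsProbabilityMeasure μ] {ξ : Ω → α} (hξ : Measurable ξ) :
    condPartitionEntropy μ ξ ⊥ = partitionEntropy μ ξ := by
  simp only [condPartitionEntropy, condExp_bot, partitionEntropy,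
    integral_indicator_const _ (hξ (measurableSet_singleton _)), smul_eq_mul, mul_one,
    integral_const, probReal_univ, one_mul]

/-- Entropy is invariant under injective relabelling of the atoms (the partition `{A_a}` does
not change): `H(e ∘ ξ) = H(ξ)`. [folklore] -/
theorem partitionEntropy_comp_of_injective {e : α → β} (he : Injective e) (μ : Measure Ω)
    (ξ : Ω → α) : partitionEntropy μ (e ∘ ξ) = partitionEntropy μ ξ :=
  sum_preimage_comp_singleton_of_injective he ξ (fun s => negMulLog (μ.real s)) (by simp)

/-- Conditional entropy is invariant under injective relabelling of the atoms:
`H(e ∘ ξ | m) = H(ξ | m)`. [folklore] -/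
theorem condPartitionEntropy_comp_of_injective {e : α → β} (he : Injective e) (μ : Measure Ω)
    (ξ : Ω → α) (m : MeasurableSpace Ω) :
    condPartitionEntropy μ (e ∘ ξ) m = condPartitionEntropy μ ξ m := by
  unfold condPartitionEntropy
  congr 1 with ω
  refine sum_preimage_comp_singleton_of_injective he ξ
    (fun s => negMulLog ((μ[s.indicator (fun _ => (1 : ℝ)) | m]) ω)) ?_
  simp only [Set.indicator_empty', condExp_zero, Pi.zero_apply, negMulLog_zero]

end Partition

/-! ### Itineraries: the joins `⋁_{i<n} T^{-i} ξ` -/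

/-- The **itinerary** (or `(ξ, n)`-name) map of a self-map `T` and a partition `ξ : Ω → α`:
`itinerary T ξ n ω = (ξ ω, ξ (T ω), …, ξ (T^{n-1} ω))`. As a partition of `Ω` this is the join
`⋁_{i=0}^{n-1} T^{-i} ξ`, whose atoms are the sets `⋂_{i<n} T^{-i} A_{w i}`, `w : Fin n → α`
(`preimage_itinerary_singleton`). [cite: Walters1982, Def 4.4 and §4.4] -/
def itinerary (T : Ω → Ω) (ξ : Ω → α) (n : ℕ) : Ω → Fin n → α := fun ω i => ξ (T^[i] ω)

section Itinerary

variable {T : Ω → Ω} {ξ : Ω → α} {n : ℕ}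

/-- Unfolding `itinerary`. [cite: Walters1982, Def 4.4] -/
@[simp] theorem itinerary_apply (T : Ω → Ω) (ξ : Ω → α) (n : ℕ) (ω : Ω) (i : Fin n) :
    itinerary T ξ n ω i = ξ (T^[i] ω) := rfl

/-- The atoms of `⋁_{i<n} T^{-i} ξ` are the sets `⋂_{i<n} T^{-i}(ξ⁻¹{w i})`.
[cite: Walters1982, §4.4 (before Def 4.9)] -/
theorem preimage_itinerary_singleton (T : Ω → Ω) (ξ : Ω → α) (n : ℕ) (w : Fin n → α) :
    itinerary T ξ n ⁻¹' {w} = ⋂ i : Fin n, T^[i] ⁻¹' (ξ ⁻¹' {w i}) := by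
  ext ω
  simp only [Set.mem_preimage, Set.mem_singleton_iff, Set.mem_iInter, funext_iff,
    itinerary_apply]

/-- Relabelling/coarsening the partition commutes with taking itineraries:
`⋁ T^{-i}(f ∘ ξ) = (f ∘ ·) ∘ ⋁ T^{-i} ξ`. [folklore] -/
theorem itinerary_comp (T : Ω → Ω) (ξ : Ω → α) (f : α → β) (n : ℕ) :
    itinerary T (f ∘ ξ) n = (fun w => f ∘ w) ∘ itinerary T ξ n := rfl

/-- `T⁻¹(⋁_{i<n} T^{-i} ξ) = ⋁_{i<n} T^{-i} (T⁻¹ ξ)`: itineraries of `ξ ∘ T` are itineraries of `ξ`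
precomposed with `T`. [cite: Walters1982, Def 4.4 (identities)] -/
theorem itinerary_comp_self (T : Ω → Ω) (ξ : Ω → α) (n : ℕ) :
    itinerary T (ξ ∘ T) n = itinerary T ξ n ∘ T := by
  funext ω i
  simp only [itinerary_apply, comp_apply, ← iterate_succ_apply, iterate_succ_apply']

/-- Itineraries are measurable when `T` and `ξ` are. [folklore] -/
@[fun_prop]
theorem measurable_itinerary [MeasurableSpace Ω] [MeasurableSpace α] (hT : Measurable T)
    (hξ : Measurable ξ) (n : ℕ) : Measurable (itinerary T ξ n) :=
  measurable_pi_lambda _ fun i => hξ.comp (hT.iterate i)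

end Itinerary

/-! ### Entropy of a transformation relative to a partition; the Kolmogorov–Sinai entropy -/

section Dynamic

variable [Fintype α] [Fintype β]

/-- The **entropy of `T` with respect to the finite partition `ξ`**,
`h_μ(T, ξ) = lim_n (1/n) H_μ(⋁_{i<n} T^{-i} ξ)`. Walters defines it as this limit and shows
(Thm 4.9 = Fekete's lemma, Cor 4.9.1, Thm 4.10) that for measure-preserving `T` the limit exists
and equals `inf_{n≥1} (1/n) H_μ(⋁_{i<n} T^{-i} ξ)` (the sequence even decreases to it); we
DEFINE it as that infimum (indexing by `n+1`); see `tendsto_partitionEntropy_itinerary_div` for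
the limit statement. [cite: Walters1982, Def 4.9 with Thm 4.9 / Cor 4.9.1] -/
def dynEntropy {mΩ : MeasurableSpace Ω} (μ : Measure Ω) (T : Ω → Ω) (ξ : Ω → α) : ℝ :=
  ⨅ n : ℕ, partitionEntropy μ (itinerary T ξ (n + 1)) / (n + 1)

/-- The **conditional dynamical entropy of `ξ` given a (sub-invariant) sub-σ-algebra `m`**,
`h_μ(T, ξ | m) = lim_n ↓ (1/n) H_μ(⋁_{i<n} T^{-i} ξ | m)` (Downarowicz writes `h(μ, T, 𝒫 | 𝔅)`,
`𝔅` subinvariant: `T⁻¹𝔅 ⊆ 𝔅`); as for `dynEntropy` we define it as the infimum over `n ≥ 1`,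
which is the limit by subadditivity (Downarowicz Fact 2.3.1;
`tendsto_condPartitionEntropy_itinerary_div`). [cite: Downarowicz2011, Def 2.3.3] -/
def condDynEntropy {mΩ : MeasurableSpace Ω} (μ : Measure Ω) (T : Ω → Ω) (ξ : Ω → α)
    (m : MeasurableSpace Ω) : ℝ :=
  ⨅ n : ℕ, condPartitionEntropy μ (itinerary T ξ (n + 1)) m / (n + 1)

/-- The **(Kolmogorov–Sinai) entropy of the transformation `T`** of the probability space
`(Ω, μ)`: `h_μ(T) = sup_ξ h_μ(T, ξ) ∈ [0, +∞]`, the supremum over all finite measurable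
partitions `ξ` — here over all measurable `ξ : Ω → Fin k`, `k ∈ ℕ` (every finite measurable
partition is an injective relabelling of one of these, and `h(T, ·)` is relabelling invariant:
`ofReal_dynEntropy_le_kolmogorovSinaiEntropy`). Valued in `ℝ≥0∞` since it "could be `+∞`"
(Remark (1) loc. cit.). [cite: Walters1982, Def 4.10] -/
def kolmogorovSinaiEntropy {mΩ : MeasurableSpace Ω} (μ : Measure Ω) (T : Ω → Ω) : ℝ≥0∞ :=
  ⨆ (k : ℕ) (ξ : Ω → Fin k) (_ : Measurable ξ), ENNReal.ofReal (dynEntropy μ T ξ)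

/-- The **conditional entropy of `T` given a (sub-invariant) sub-σ-algebra `m`** (entropy of the
system relative to the factor `m`): `h_μ(T | m) = sup_ξ h_μ(T, ξ | m)`, rendered as for
`kolmogorovSinaiEntropy` with the supremum over finite measurable partitions (Downarowicz: over
countable partitions of finite static entropy). [cite: Downarowicz2011, Def 4.1.5] -/
def condKolmogorovSinaiEntropy {mΩ : MeasurableSpace Ω} (μ : Measure Ω) (T : Ω → Ω)
    (m : MeasurableSpace Ω) : ℝ≥0∞ :=
  ⨆ (k : ℕ) (ξ : Ω → Fin k) (_ : Measurable[mΩ] ξ), ENNReal.ofReal (condDynEntropy μ T ξ m)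

variable {mΩ : MeasurableSpace Ω} {μ : Measure Ω} {T : Ω → Ω} {ξ : Ω → α}

/-- Unfolding `dynEntropy`. [cite: Walters1982, Def 4.9] -/
theorem dynEntropy_def (μ : Measure Ω) (T : Ω → Ω) (ξ : Ω → α) :
    dynEntropy μ T ξ = ⨅ n : ℕ, partitionEntropy μ (itinerary T ξ (n + 1)) / (n + 1) := rfl

/-- Unfolding `condDynEntropy`. [cite: Downarowicz2011, Def 2.3.3] -/
theorem condDynEntropy_def (μ : Measure Ω) (T : Ω → Ω) (ξ : Ω → α) (m : MeasurableSpace Ω) :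
    condDynEntropy μ T ξ m =
      ⨅ n : ℕ, condPartitionEntropy μ (itinerary T ξ (n + 1)) m / (n + 1) := rfl

/-- Unfolding `kolmogorovSinaiEntropy`. [cite: Walters1982, Def 4.10] -/
theorem kolmogorovSinaiEntropy_def (μ : Measure Ω) (T : Ω → Ω) :
    kolmogorovSinaiEntropy μ T =
      ⨆ (k : ℕ) (ξ : Ω → Fin k) (_ : Measurable ξ), ENNReal.ofReal (dynEntropy μ T ξ) := rfl

/-- Unfolding `condKolmogorovSinaiEntropy`. [cite: Downarowicz2011, Def 4.1.5] -/
theorem condKolmogorovSinaiEntropy_def (μ : Measure Ω) (T : Ω → Ω) (m : MeasurableSpace Ω) :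
    condKolmogorovSinaiEntropy μ T m =
      ⨆ (k : ℕ) (ξ : Ω → Fin k) (_ : Measurable[mΩ] ξ),
        ENNReal.ofReal (condDynEntropy μ T ξ m) := rfl

/-- `h(T, ξ) ≥ 0` (Walters, Remark after Def 4.9). [cite: Walters1982, §4.4 Remark after Def 4.9] -/
theorem dynEntropy_nonneg [IsZeroOrProbabilityMeasure μ] (T : Ω → Ω) (ξ : Ω → α) :
    0 ≤ dynEntropy μ T ξ :=
  Real.iInf_nonneg fun _ => div_nonneg (partitionEntropy_nonneg _) (by positivity)

/-- `h(T, ξ | m) ≥ 0`. [cite: Downarowicz2011, Def 2.3.3] -/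
theorem condDynEntropy_nonneg [IsFiniteMeasure μ] (T : Ω → Ω) (ξ : Ω → α)
    (m : MeasurableSpace Ω) : 0 ≤ condDynEntropy μ T ξ m :=
  Real.iInf_nonneg fun _ => div_nonneg (condPartitionEntropy_nonneg _ _) (by positivity)

/-- `h(T, ξ | 𝒩) = h(T, ξ)` for the trivial σ-algebra `𝒩 = ⊥` (from `H(· | 𝒩) = H(·)`, Walters
§4.3). [cite: Walters1982, §4.3 after Def 4.7] -/
theorem condDynEntropy_bot [MeasurableSpace α] [MeasurableSingletonClass α]
    [IsProbabilityMeasure μ] (hT : Measurable T) (hξ : Measurable ξ) :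
    condDynEntropy μ T ξ ⊥ = dynEntropy μ T ξ := by
  unfold condDynEntropy dynEntropy
  refine iInf_congr fun n => ?_
  rw [condPartitionEntropy_bot (measurable_itinerary hT hξ _)]

/-- `h(T, ·)` is invariant under injective relabelling of the atoms. [folklore] -/
theorem dynEntropy_comp_of_injective {e : α → β} (he : Injective e) (μ : Measure Ω)
    (T : Ω → Ω) (ξ : Ω → α) : dynEntropy μ T (e ∘ ξ) = dynEntropy μ T ξ := by
  unfold dynEntropy
  refine iInf_congr fun n => ?_
  rw [itinerary_comp, partitionEntropy_comp_of_injective he.comp_left μ (itinerary T ξ (n + 1))]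

/-- `h(T, · | m)` is invariant under injective relabelling of the atoms. [folklore] -/
theorem condDynEntropy_comp_of_injective {e : α → β} (he : Injective e) (μ : Measure Ω)
    (T : Ω → Ω) (ξ : Ω → α) (m : MeasurableSpace Ω) :
    condDynEntropy μ T (e ∘ ξ) m = condDynEntropy μ T ξ m := by
  unfold condDynEntropy
  refine iInf_congr fun n => ?_
  rw [itinerary_comp,
    condPartitionEntropy_comp_of_injective he.comp_left μ (itinerary T ξ (n + 1)) m]

/-- Every finite measurable partition competes in the supremum defining `h(T)`:
`h(T, ξ) ≤ h(T)` (as `ENNReal.ofReal`). [cite: Walters1982, Def 4.10] -/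
theorem ofReal_dynEntropy_le_kolmogorovSinaiEntropy [MeasurableSpace α]
    [MeasurableSingletonClass α] (μ : Measure Ω) (T : Ω → Ω) {ξ : Ω → α} (hξ : Measurable ξ) :
    ENNReal.ofReal (dynEntropy μ T ξ) ≤ kolmogorovSinaiEntropy μ T := by
  classical
  set e := Fintype.equivFin α
  have hmeas : Measurable (e ∘ ξ) := (measurable_of_finite _).comp hξ
  rw [← dynEntropy_comp_of_injective e.injective]
  exact le_iSup_of_le (Fintype.card α) <| le_iSup_of_le (e ∘ ξ) <| le_iSup_of_le hmeas le_rfl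

/-- `h(T, ξ | m) ≤ h(T | m)` for every finite measurable partition `ξ`.
[cite: Downarowicz2011, Def 4.1.5] -/
theorem ofReal_condDynEntropy_le_condKolmogorovSinaiEntropy [MeasurableSpace α]
    [MeasurableSingletonClass α] (μ : Measure Ω) (T : Ω → Ω) {ξ : Ω → α} (hξ : Measurable ξ)
    (m : MeasurableSpace Ω) :
    ENNReal.ofReal (condDynEntropy μ T ξ m) ≤ condKolmogorovSinaiEntropy μ T m := by
  classical
  set e := Fintype.equivFin α
  have hmeas : Measurable[mΩ] (e ∘ ξ) := (measurable_of_finite _).comp hξ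
  rw [← condDynEntropy_comp_of_injective e.injective]
  exact le_iSup_of_le (Fintype.card α) <| le_iSup_of_le (e ∘ ξ) <| le_iSup_of_le hmeas le_rfl

end Dynamic

end Literature.Dynamics.Ergodic
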